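import Mathlib
import Summits.ResolutionOfSingularities.ResolutionOfSingularities.Theorems.WildQuotientsWildQuotientResolutionPthConeFanCharts
import Summits.ResolutionOfSingularities.ResolutionOfSingularities.Theorems.WildQuotientsWildQuotientResolutionPthConeFanCover

/-!
# F6 — the toric brick `T(a,b)`: `Bl_𝔞 (1/p)(1 on I, −1 off I)` is regular and `√𝔞` is the vertex
(crux stmt-ResolutionOfSingularities-15640 `WildQuotients.WildQuotientResolution`, line `Sketch`;
chain w45c POST-V5 S2 = the conductor-𝟙 core `ConductorOneCore p n` of bricks, brick **F6
`…ConductorOneToricFan`** of res-L1-w45c-lead-1's `S2-DESIGN.md` §3 / §6 / §7 (7.6) (architecture of record,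
res-L1-w45c-plan-1 RULING 2026-08-27T17:07:17Z), in the HT binder shape of record (plan-1 RULINGs 16:55:33Z (5),
17:31:45Z (2); lead-1 SIG (R5) 17:27:55Z for the scaffold `ConductorOne.conductorOneCore_hasResolution_of_bricks`):
`HT : ∀ I, ∃ J₀ : Ideal ↥(PthCone.cone k n p (chartWeight p n I)), J₀.radical = PthCone.irrelevant k n p
(chartWeight p n I) ∧ Scheme.IsRegular (affineBlowup J₀)`.
[OURS · L1 W4.5c] — NOT a statement of any manuscript; replaces the role of no printed item («the exits of
the residual `μ_p`-points of the conductor-one core are toric»). Owner res-L1-w45c-stub-4 (gen 5).)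

`J₀ := PthCone.fanIdeal k n p I` = the fan ideal `𝔞_{a,b}` (…PthConeFanDefs: vertices
`x_ρ^{(p−j)(p−j−1)} x_{ρ'}^{j(j+1)}`, `ρ ∈ I`, `ρ' ∉ I`, `0 ≤ j ≤ p−1`, of the Newton polyhedron of the support
function `ψ(v_j) = j(p−j)` on the fan `Σ_{a,b}` of S2-DESIGN §3, plus the «vertex + dual basis» monomials):
* `PthCone.fanIdeal_radical` — `√𝔞 = irrelevant` (the generators are non-constant monomials and `x_l^{p²} ∈ 𝔞`
  for every `l`; radical criterion `PthCone.radical_eq_irrelevant_of_pow_mem`, …PthConeIrrelevant);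
* `PthCone.isRegular_affineBlowup_fan` — `Bl_𝔞` is regular: every generator chart lies in a vertex chart
  (…PthConeFanCover) and the three kinds of vertex charts are affine spaces (…PthConeFanCharts ←
  …ChartEnd / …ChartMid ← the symbolic engine …PthConeFanEngine); assembly by
  `JordanThree.isRegular_affineBlowup_of_charts`;
* `PthCone.fan_blowup_regular` — regular ∧ proper (and integral ∧ birational when `n ≥ 1`);
* **`ConductorOne.toricBrick (p) (hp : p.Prime) (k) (n) (I) : ∃ J₀, J₀.radical = PthCone.irrelevant k n p
  (chartWeight p n I) ∧ Scheme.IsRegular (affineBlowup J₀)`** — HT, for EVERY prime `p` (including `p = 2`)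
  and EVERY `I` (including `I = univ`, the Veronese type, and `I = ∅`): no case split is left to F8/F9.
No notation.
-/

set_option linter.dupNamespace false

noncomputable section

open MvPolynomial AlgebraicGeometry
open Literature.AlgebraicGeometry.Resolution

namespace Summit.ResolutionOfSingularities.ResolutionOfSingularities.Theorems.WildQuotientResolution.PthCone

open ConductorOne

universe u

variable (k : Type) [Field k] (n p : ℕ) (A : Finset (Fin n)) [hp : Fact p.Prime]

/-! ## The radical of the fan ideal -/

/-- A finitely supported function dominating a positive single is non-zero. [folklore] -/
theorem finsupp_ne_zero_of_single_le {d : Fin n →₀ ℕ} {x : Fin n} {b : ℕ} (hb : 0 < b)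
    (h : Finsupp.single x b ≤ d) : d ≠ 0 := by
  intro h0
  have hx := h x
  rw [h0, Finsupp.single_eq_same, Finsupp.zero_apply] at hx
  omega

/-- The exponents of the fan generators are non-zero. [OURS · L1 W4.5c] -/
theorem fanExp_ne_zero (κ : FIdx n p A) : fanExp n p A κ ≠ 0 := by
  classical
  have hp2 : 2 ≤ p := hp.out.two_le
  have hpp : 0 < p * (p - 1) := Nat.mul_pos (by omega) (by omega)
  rcases κ with (((ρ | ρ) | (⟨ρ, l⟩ | ⟨ρ, l'⟩)) | ((ρ' | ρ') | (⟨ρ', l'⟩ | ⟨ρ', l⟩))) |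
    ((⟨j, ρ, ρ'⟩ | ⟨i, ρ, ρ'⟩) | (⟨j, ρ, ρ', l⟩ | ⟨j, ρ, ρ', l'⟩))
  · exact finsupp_ne_zero_of_single_le n hpp le_rfl
  · exact finsupp_ne_zero_of_single_le n (b := p ^ 2) (by positivity) le_rfl
  · exact finsupp_ne_zero_of_single_le n Nat.one_pos le_add_self
  · exact finsupp_ne_zero_of_single_le n Nat.one_pos le_add_self
  · exact finsupp_ne_zero_of_single_le n hpp le_rfl
  · exact finsupp_ne_zero_of_single_le n (b := p ^ 2) (by positivity) le_rfl
  · exact finsupp_ne_zero_of_single_le n Nat.one_pos le_add_self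
  · exact finsupp_ne_zero_of_single_le n Nat.one_pos le_add_self
  · exact finsupp_ne_zero_of_single_le n (x := (ρ' : Fin n)) (b := ((j : ℕ) + 1) * ((j : ℕ) + 1 + 1))
      (by positivity) le_add_self
  · exact finsupp_ne_zero_of_single_le n (x := (ρ' : Fin n)) (b := ((i : ℕ) + 1) ^ 2) (by positivity)
      le_add_self
  · exact finsupp_ne_zero_of_single_le n Nat.one_pos le_add_self
  · exact finsupp_ne_zero_of_single_le n Nat.one_pos le_add_self

/-- The fan ideal lies in the irrelevant ideal. [OURS · L1 W4.5c] -/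
theorem fanIdeal_le_irrelevant : fanIdeal n p A k ≤ irrelevant k n p (chartWeight p n A) := by
  unfold fanIdeal
  rw [Ideal.span_le, range_fanFamily]
  rintro _ ⟨κ, rfl⟩
  exact mem_irrelevant_of_coe_eq_monomial k n p _ _ (fanExp n p A κ) (fanExp_ne_zero n p A κ) (coe_fanGen n p A k κ)

/-- `x_l^{p²}` lies in the fan ideal, for every variable `l` (kind `q0` for `l ∈ A`, `qp` for `l ∉ A`).
[OURS · L1 W4.5c] -/
theorem X_pow_sq_mem_fanIdeal (l : Fin n) :
    (⟨X l ^ (p ^ 2), X_pow_mem_cone_of_dvd k n p (chartWeight p n A) l (dvd_pow_self p two_ne_zero)⟩ :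
      cone k n p (chartWeight p n A)) ∈ fanIdeal n p A k := by
  classical
  by_cases hl : l ∈ A
  · have h : (⟨X l ^ (p ^ 2), X_pow_mem_cone_of_dvd k n p (chartWeight p n A) l (dvd_pow_self p two_ne_zero)⟩ :
        cone k n p (chartWeight p n A)) = fanGen n p A k (FIdx.q0 ⟨l, hl⟩) :=
      Subtype.ext (by change X l ^ (p ^ 2) = _; rw [coe_fanGen, fanExp_q0, X_pow_eq_monomial])
    rw [h]; exact fanGen_mem_fanIdeal n p A k _
  · have h : (⟨X l ^ (p ^ 2), X_pow_mem_cone_of_dvd k n p (chartWeight p n A) l (dvd_pow_self p two_ne_zero)⟩ :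
        cone k n p (chartWeight p n A)) = fanGen n p A k (FIdx.qp ⟨l, Finset.mem_compl.mpr hl⟩) :=
      Subtype.ext (by change X l ^ (p ^ 2) = _; rw [coe_fanGen, fanExp_qp, X_pow_eq_monomial])
    rw [h]; exact fanGen_mem_fanIdeal n p A k _

/-- **The radical of the fan ideal is the irrelevant ideal** (the ideal of the vertex). [OURS · L1 W4.5c] -/
theorem fanIdeal_radical : (fanIdeal n p A k).radical = irrelevant k n p (chartWeight p n A) :=
  radical_eq_irrelevant_of_pow_mem k n p _ _ (fanIdeal_le_irrelevant k n p A) (fun _ => p ^ 2)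
    (fun _ => dvd_pow_self p two_ne_zero) (X_pow_sq_mem_fanIdeal k n p A)

/-! ## The blow-up of the fan ideal is regular -/

omit hp in
/-- `vtxExp (p−2) l ρ'` in the form produced by `smul_x_eq` (for the `xp` relation). [OURS · L1 W4.5c] -/
theorem vtxExp_sub_two (hp2 : 2 ≤ p) (l ρ' : Fin n) :
    vtxExp n p (p - 2) l ρ' =
      Finsupp.single ρ' ((p - 1) * (p - 1 - 1)) + Finsupp.single l (1 * (1 + 1)) := by
  rw [vtxExp, add_comm, show p - (p - 2) = 2 by omega, show p - 2 + 1 = p - 1 by omega,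
    show p - 1 - 1 = p - 2 by omega, mul_comm (p - 2)]

omit hp in
/-- `(j+1)(j+2) = (j+1)(j+1+1)` inside `vtxExp`. [folklore] -/
theorem vtxExp_succ (j : ℕ) (ρ ρ' : Fin n) :
    vtxExp n p (j + 1) ρ ρ' =
      Finsupp.single ρ ((p - (j + 1)) * (p - (j + 1) - 1)) + Finsupp.single ρ' ((j + 1) * (j + 2)) :=
  rfl

-- twelve kinds of generators, each placed in a vertex chart
set_option maxHeartbeats 800000 in
/-- **`Bl_𝔞 (1/p)(1 on A, −1 off A)` is regular**, for every prime `p` and every `A`: the vertex charts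
`v0 / vp / vm` are affine spaces (…PthConeFanCharts) and every other generator chart lies in one of them
(…PthConeFanCover). [OURS · L1 W4.5c] -/
theorem isRegular_affineBlowup_fan : Scheme.IsRegular (affineBlowup (fanIdeal n p A k)) := by
  classical
  have hp2 : 2 ≤ p := hp.out.two_le
  let e := Fintype.equivFin (FIdx n p A)
  show Scheme.IsRegular (affineBlowup (Ideal.span (Set.range (fanFamily n p A k))))
  refine JordanThree.isRegular_affineBlowup_of_charts (fanFamily n p A k) fun i => ?_
  obtain ⟨κ, rfl⟩ := e.surjective i
  have hne : ∀ (ρ : A) (ρ' : (Aᶜ : Finset (Fin n))), (ρ : Fin n) ≠ (ρ' : Fin n) :=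
    fun ρ ρ' h => Finset.mem_compl.mp ρ'.2 (h ▸ ρ.2)
  rcases κ with (((ρ | ρ) | (⟨ρ, l⟩ | ⟨ρ, l'⟩)) | ((ρ' | ρ') | (⟨ρ', l'⟩ | ⟨ρ', l⟩))) |
    ((⟨j, ρ, ρ'⟩ | ⟨i, ρ, ρ'⟩) | (⟨j, ρ, ρ', l⟩ | ⟨j, ρ, ρ', l'⟩))
  · -- v0
    exact ⟨e (FIdx.v0 ρ), isRegularRing_chartRing_v0 k n p A ρ, le_rfl⟩
  · -- q0
    exact ⟨e (FIdx.v0 ρ), isRegularRing_chartRing_v0 k n p A ρ,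
      basicOpen_le_of_pure k n p A (FIdx.q0 ρ) (FIdx.v0 ρ) ρ (fanExp_q0 ρ) (fanExp_v0 ρ)⟩
  · -- e0
    refine ⟨e (FIdx.v0 ρ), isRegularRing_chartRing_v0 k n p A ρ,
      basicOpen_le_of_expRel k n p A (FIdx.e0 ρ l) (FIdx.v0 ρ) (FIdx.v0 l) (p * (p - 1) - 2) ?_⟩
    have hR : 2 ≤ p * (p - 1) := Nat.mul_le_mul hp2 (show 1 ≤ p - 1 by omega)
    simpa only [add_zero, fanExp_e0, fanExp_v0] using smul_moved_eq n (p * (p - 1)) hR ρ l 0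
  · -- x0
    obtain ⟨κ₂, hκ₂⟩ := exists_fanExp_eq_vtxExp n p A 1 hp2 ρ l'
    refine ⟨e (FIdx.v0 ρ), isRegularRing_chartRing_v0 k n p A ρ,
      basicOpen_le_of_expRel k n p A (FIdx.x0 ρ l') (FIdx.v0 ρ) κ₂ 0 ?_⟩
    rw [fanExp_x0, fanExp_v0, hκ₂, vtxExp]
    exact smul_x_eq n p hp2 ρ l' (hne ρ l')
  · -- vp
    exact ⟨e (FIdx.vp ρ'), isRegularRing_chartRing_vp k n p A ρ', le_rfl⟩
  · -- qp
    exact ⟨e (FIdx.vp ρ'), isRegularRing_chartRing_vp k n p A ρ',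
      basicOpen_le_of_pure k n p A (FIdx.qp ρ') (FIdx.vp ρ') ρ' (fanExp_qp ρ') (fanExp_vp ρ')⟩
  · -- ep
    refine ⟨e (FIdx.vp ρ'), isRegularRing_chartRing_vp k n p A ρ',
      basicOpen_le_of_expRel k n p A (FIdx.ep ρ' l') (FIdx.vp ρ') (FIdx.vp l') (p * (p - 1) - 2) ?_⟩
    have hR : 2 ≤ p * (p - 1) := Nat.mul_le_mul hp2 (show 1 ≤ p - 1 by omega)
    simpa only [add_zero, fanExp_ep, fanExp_vp] using smul_moved_eq n (p * (p - 1)) hR ρ' l' 0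
  · -- xp
    obtain ⟨κ₂, hκ₂⟩ := exists_fanExp_eq_vtxExp n p A (p - 2) (by omega) l ρ'
    refine ⟨e (FIdx.vp ρ'), isRegularRing_chartRing_vp k n p A ρ',
      basicOpen_le_of_expRel k n p A (FIdx.xp ρ' l) (FIdx.vp ρ') κ₂ 0 ?_⟩
    rw [fanExp_xp, fanExp_vp, hκ₂, vtxExp_sub_two n p hp2]
    exact smul_x_eq n p hp2 ρ' l (hne l ρ').symm
  · -- vm
    exact ⟨e (FIdx.vm j ρ ρ'), isRegularRing_chartRing_vm k n p A j ρ ρ', le_rfl⟩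
  · -- qm
    have hi : (i : ℕ) + 2 ≤ p := by have := i.2; omega
    obtain ⟨κ₂, hκ₂⟩ := exists_fanExp_eq_vtxExp n p A ((i : ℕ) + 1) hi ρ ρ'
    by_cases hi0 : (i : ℕ) = 0
    · refine ⟨e (FIdx.v0 ρ), isRegularRing_chartRing_v0 k n p A ρ,
        basicOpen_le_of_expRel k n p A (FIdx.qm i ρ ρ') (FIdx.v0 ρ) κ₂ 0 ?_⟩
      have hv0 : fanExp n p A (FIdx.v0 ρ) = vtxExp n p 0 ρ ρ' := by
        rw [fanExp_v0, vtxExp, Nat.sub_zero, zero_mul, Finsupp.single_zero, add_zero]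
      rw [fanExp_qm, hv0, hκ₂, hi0]
      exact smul_q_eq n p 0 (by omega) ρ ρ' (hne ρ ρ')
    · have hi1 : 1 ≤ (i : ℕ) := Nat.one_le_iff_ne_zero.mpr hi0
      let j' : Fin (p - 2) := ⟨(i : ℕ) - 1, by omega⟩
      refine ⟨e (FIdx.vm j' ρ ρ'), isRegularRing_chartRing_vm k n p A j' ρ ρ',
        basicOpen_le_of_expRel k n p A (FIdx.qm i ρ ρ') (FIdx.vm j' ρ ρ') κ₂ 0 ?_⟩
      rw [fanExp_qm, fanExp_vm, hκ₂, show (j' : ℕ) + 1 = (i : ℕ) from Nat.sub_add_cancel hi1]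
      exact smul_q_eq n p (i : ℕ) hi ρ ρ' (hne ρ ρ')
  · -- ea
    have hj : (j : ℕ) + 3 ≤ p := by have := j.2; omega
    refine ⟨e (FIdx.vm j ρ ρ'), isRegularRing_chartRing_vm k n p A j ρ ρ',
      basicOpen_le_of_expRel k n p A (FIdx.ea j ρ ρ' l) (FIdx.vm j ρ ρ') (FIdx.vm j l ρ')
        ((p - ((j : ℕ) + 1)) * (p - ((j : ℕ) + 1) - 1) - 2) ?_⟩
    have hR : 2 ≤ (p - ((j : ℕ) + 1)) * (p - ((j : ℕ) + 1) - 1) :=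
      Nat.mul_le_mul (show 2 ≤ p - ((j : ℕ) + 1) by omega) (show 1 ≤ p - ((j : ℕ) + 1) - 1 by omega)
    rw [fanExp_ea, fanExp_vm, fanExp_vm, vtxExp_succ, vtxExp_succ]
    exact smul_moved_eq n _ hR ρ l (Finsupp.single (ρ' : Fin n) (((j : ℕ) + 1) * ((j : ℕ) + 2)))
  · -- eb
    refine ⟨e (FIdx.vm j ρ ρ'), isRegularRing_chartRing_vm k n p A j ρ ρ',
      basicOpen_le_of_expRel k n p A (FIdx.eb j ρ ρ' l') (FIdx.vm j ρ ρ') (FIdx.vm j ρ l')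
        (((j : ℕ) + 1) * ((j : ℕ) + 2) - 2) ?_⟩
    have hS : 2 ≤ ((j : ℕ) + 1) * ((j : ℕ) + 2) :=
      Nat.mul_le_mul (show 1 ≤ (j : ℕ) + 1 by omega) (show 2 ≤ (j : ℕ) + 2 by omega)
    rw [fanExp_eb, fanExp_vm, fanExp_vm, vtxExp_succ, vtxExp_succ]
    exact smul_moved_eq' n _ hS ρ' l' (Finsupp.single (ρ : Fin n) ((p - ((j : ℕ) + 1)) * (p - ((j : ℕ) + 1) - 1)))

/-- **F6, assembled form.** `Bl_𝔞` is regular and proper over the cone, and `√𝔞 = irrelevant`.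
[OURS · L1 W4.5c] -/
theorem fan_blowup_regular :
    (fanIdeal n p A k).radical = irrelevant k n p (chartWeight p n A) ∧
      Scheme.IsRegular (affineBlowup (fanIdeal n p A k)) ∧
      IsProper (affineBlowup.π (fanIdeal n p A k)) :=
  ⟨fanIdeal_radical k n p A, isRegular_affineBlowup_fan k n p A,
    affineBlowup.isProper_of_fg _ (Submodule.fg_span (Set.finite_range (fanFamily n p A k)))⟩

end Summit.ResolutionOfSingularities.ResolutionOfSingularities.Theorems.WildQuotientResolution.PthCone

namespace Summit.ResolutionOfSingularities.ResolutionOfSingularities.Theorems.WildQuotientResolution.ConductorOne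

open PthCone

/-- **HT — the toric brick `T(a,b)` of the conductor-𝟙 core** (S2-DESIGN §3/§5, binder of
`ConductorOne.conductorOneCore_hasResolution_of_bricks`): for every prime `p`, field `k`, `n` and
`I ⊆ {1,…,n}`, the local toric model `Spec (PthCone.cone k n p (chartWeight p n I))` of the residual
`μ_p`-point `Q_I` has an ideal `J₀` (the fan ideal `𝔞_{|I|, n−|I|}`) with `√J₀ =` the vertex and `Bl_{J₀}`
regular. Uniform in `p` (incl. `p = 2`) and in `I` (incl. the Veronese types `I = univ`, `I = ∅`).
[OURS · L1 W4.5c] — discharges `HT` for every `I`; no statement of any manuscript. -/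
theorem toricBrick (p : ℕ) (hp : p.Prime) (k : Type) [Field k] (n : ℕ) (I : Finset (Fin n)) :
    ∃ J₀ : Ideal (PthCone.cone k n p (chartWeight p n I)),
      J₀.radical = PthCone.irrelevant k n p (chartWeight p n I) ∧ Scheme.IsRegular (affineBlowup J₀) := by
  haveI : Fact p.Prime := ⟨hp⟩
  exact ⟨fanIdeal n p I k, fanIdeal_radical k n p I, isRegular_affineBlowup_fan k n p I⟩

/-- HT with properness of the blow-up recorded as well. [OURS · L1 W4.5c] -/
theorem toricBrick_proper (p : ℕ) (hp : p.Prime) (k : Type) [Field k] (n : ℕ) (I : Finset (Fin n)) :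
    ∃ J₀ : Ideal (PthCone.cone k n p (chartWeight p n I)),
      J₀.radical = PthCone.irrelevant k n p (chartWeight p n I) ∧ Scheme.IsRegular (affineBlowup J₀) ∧
        IsProper (affineBlowup.π J₀) := by
  haveI : Fact p.Prime := ⟨hp⟩
  exact ⟨fanIdeal n p I k, fan_blowup_regular k n p I⟩

end Summit.ResolutionOfSingularities.ResolutionOfSingularities.Theorems.WildQuotientResolution.ConductorOne

end
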